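import Literature.MathematicalPhysics.QuantumFieldTheory.BalabanImbrieJaffe1984to88.BIJ88Eq5145CornerW6Loc
import Literature.MathematicalPhysics.QuantumFieldTheory.BalabanImbrieJaffe1984to88.BIJ88Ineq5144LocatedWitness
import Literature.MathematicalPhysics.QuantumFieldTheory.BalabanImbrieJaffe1984to88.BIJ88CutoffProfileWitness

/-!
# `BalabanImbrieJaffe1984to88.BIJ88Eq5145LocatedInstance` — T. Bałaban, J. Imbrie, A. Jaffe, *Effective action and cluster properties of the
abelian Higgs model*, Commun. Math. Phys. **114** (1988) 257–315 [BalabanImbrieJaffe1988], Sect. 5.14, (5.14.5) p. 312 [PDF 56] with (5.14.4)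
p. 309: **THE LOCATED C2.Eq5.14.5 HEAD THEOREM INSTANTIATED — A KERNEL CERTIFICATE THAT ITS HYPOTHESIS FAMILY IS JOINTLY SATISFIABLE**
(GAPS G-C2-p36-07 №1/№2: the landed heads of record are vacuous; the owner's flip criterion for the located twin is «hypotheses jointly satisfiable»).

statement-level skeleton of published theorems with citation tags; proofs where landed; nothing here is a claim about the Yang–Mills mass gap

* **`eq5145_loc_instance`** — `BIJ88Eq5145CornerW6Loc.eq5145_zG_mod_W6v_of_ineq5144_loc` APPLIED to the §5.13 data of
  `BIJ88Ineq5144LocatedWitness` (block-diagonal `Δ ≻ 0` — it couples abutting cubes only for EVERY abutting relation —, any source `ℱ`, no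
  χ-slots `B = ∅`, one interaction slot per cube with `V ≡ v`, `0 ≤ v ≤ θ`): its leaf hypothesis `h5144` (the located (5.14.4) for the located
  data of every sub-region of every `Λ₁₂` at every `t ∈ (0,1]` and every assignment) is DISCHARGED by `ineq5144_locAct_witness`, its `h311` by the
  choice `𝒫^L = 0`, `W₆″_ρ(X′) = [X′ = ∅]·𝒫̃_ρ`, the slot hypotheses trivially; what remains displayed is gen 5's numerical regime, `χ ≥ 0`,
  `p > 1/2`, `0 < e_k < e^{−1}`, a symmetric abutting relation of bounded degree, a cube-local `F`, `|L′| = n̄+1` — and the conclusion is the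
  (5.14.5) identity of the head for these data.
* **`eq5145_loc_instance_closed`** — the same with the numbers FIXED (`adj = ⊥`, `D = 0`, `θ = v = e^{−12}`, `β′ = 1`, the tree's profile
  `gevreyCutoff` (p36 g7), `p = 1`, `e_k = e^{−2}`, `F ≡ 1`, one label `L′ = Unit`): NO hypothesis is left except the model instance itself
  (`blk`, a block-diagonal `Δ ≻ 0`, `ℱ`, the cube map of the slots, `W`, `B_large`, `γ` — inhabited by the one-site one-cube model `Δ = 1`),
  so the located head's hypothesis family is jointly satisfiable, kernel-checked (`toy_regime`: `16e²·(e^{−12})^{1/2} ≤ 1` from `e ≥ 2`);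
  **`eq5145_loc_instance_unit`** — the model instance fixed as well (one site, one cube, `Δ = 1`, `ℱ = 0`): a CLOSED theorem, no hypotheses.

PDF held: `paper:balaban1988-cmp114-bij-abelian-higgs-effective-action` (journal page = PDF page + 256).  HONEST SCOPE: a degenerate but legal
instance; a satisfiability certificate for OUR typed reading, not a step of the paper's argument; (5.14.4) for the paper's data is NOT proved.
0 `sorry`, 0 definitions, 0 `Prop` facts (D-0026); imports `BIJ88Eq5145CornerW6Loc`, `BIJ88Ineq5144LocatedWitness` (p36 g14),
`BIJ88CutoffProfileWitness` (p36 g7).  NOT summit progress; NOT continuum; NOT Clay.  Cell `lit-balaban` Phase 2, seat p36 gen 14 (row C2.Eq5.14.5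
member cell, owner r16; referee ref-5).
-/

noncomputable section

open Finset MeasureTheory
open Literature.MathematicalPhysics.QuantumFieldTheory.BalabanImbrieJaffe1984to88
open BIJ88PolymerRep5134 (g1 IsAdmissible corner)
open BIJ88PolymerRep5134Gauss (expect zG)
open BIJ88Resummation5141 (outer lam12)
open BIJ88Resummation5141Adm (lam12')
open BIJ88Expansion5143Gauss (fD)
open BIJ88SlotMomentsGauss308 (uD)
open BIJ88Sect5Statements (CutoffProfile)
open BIJ88Sect5StatementsPart4 (pertP)
open BIJ88Eq5145CornerModel (ztIn)
open BIJ88W6PrimeVsupp (W6v)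
open BIJ88CutoffProfileWitness (gevreyCutoff chi1_nonneg)
open BIJ88Eq5145CornerW6Loc (eq5145_zG_mod_W6v_of_ineq5144_loc)
open BIJ88Ineq5144LocatedWitness (ineq5144_locAct_witness)

namespace Literature.MathematicalPhysics.QuantumFieldTheory.BalabanImbrieJaffe1984to88.BIJ88Eq5145LocatedInstance

variable {α I : Type} [Fintype α] [DecidableEq α] [Fintype I] [DecidableEq I]
  (blk : α → I) {Δ : Matrix α α ℝ} (ℱ : α → ℝ) (adj : I → I → Prop) [DecidableRel adj]
  (χ : CutoffProfile) {ι : Type*} [DecidableEq ι] (p ek : ℝ) (Φ : ι → (α → ℝ) → ℝ) (c : ι → ℝ) (v : ℝ)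
  {cube : ↥(∅ : Finset ι) ⊕ ↥(univ : Finset I) → I}

/-- **THE LOCATED HEAD THEOREM OF ROW C2.Eq5.14.5 INSTANTIATED ON §5.13 DATA** (block-diagonal `Δ ≻ 0`, no χ-slots, one interaction slot per
cube with `V ≡ v`, `0 ≤ v ≤ θ`): the leaf hypothesis is discharged by `BIJ88Ineq5144LocatedWitness.ineq5144_locAct_witness`, `h311` by
`𝒫^L = 0`, `W₆″_ρ(X′) = [X′ = ∅]·𝒫̃_ρ`; left displayed: gen 5's regime, `χ ≥ 0`, `p > 1/2`, `0 < e_k < e^{−1}`, a symmetric abutting relation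
of degree `≤ D`, a cube-local `F`, `|L′| = n̄+1`. [cite: BalabanImbrieJaffe1988, (5.14.5) p.312; (5.14.4) p.309; p.310 display 4; p.311] -/
theorem eq5145_loc_instance (hΔ0 : ∀ x y, blk x ≠ blk y → Δ x y = 0) (hΔ : Δ.PosDef) (hcube : ∀ Y, cube (Sum.inr Y) = Y.1)
    {nbr : I → Finset I} {D : ℕ} {θ β' : ℝ} (hR : ∀ x y, adj x y → adj y x) (hD : ∀ x, (nbr x).card ≤ D)
    (hnbr : ∀ x y, adj x y → y ∈ nbr x) (hθ0 : 0 < θ) (hθ1 : θ ≤ 1) (hβ0 : 0 ≤ β') (hβ1 : β' ≤ 1)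
    (hsmall : 16 * ((D : ℝ) + 1) ^ 2 * (θ ^ (β' / 2) * Real.exp 2) ≤ 1) (hχ : ∀ x, 0 ≤ χ.χ₁ x) (hp : 1 / 2 < p)
    (hek : 0 < ek) (hek1 : ek < Real.exp (-1)) (hv0 : 0 ≤ v) (hvθ : v ≤ θ)
    (F : I → (α → ℝ) → ℝ) (hFloc : ∀ i (φ ψ : α → ℝ), (∀ x, blk x = i → φ x = ψ x) → F i φ = F i ψ)
    {L' : Type} [Fintype L'] [DecidableEq L'] {nbar : ℕ} (hL : Fintype.card L' = nbar + 1) (W Bl : Finset I)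
    {L : Type*} (γ : L → ↥(∅ : Finset ι) ⊕ ↥(univ : Finset I)) :
    Real.exp (-0) * expect blk Δ ℱ
        (fun i φ => fD (uD χ p ek (∅ : Finset ι) Φ c (univ : Finset I) (fun _ _ => v) 1) cube γ ∅ i φ * F i φ) W (corner ℝ W) =
      ∑ ρ ∈ (outer W Bl).filter (IsAdmissible adj),
        (∏ X ∈ ρ, g1 adj (zG blk Δ ℱ (fun i φ => fD (uD χ p ek (∅ : Finset ι) Φ c (univ : Finset I) (fun _ _ => v) 1) cube γ ∅ i φ * F i φ)) X) *
          (zG blk Δ ℱ (fun i φ => fD (uD χ p ek (∅ : Finset ι) Φ c (univ : Finset I) (fun _ _ => v) 1) cube γ ∅ i φ * F i φ)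
                (lam12 W ρ) (lam12' adj W ρ) /
              zG blk Δ ℱ (fD (uD χ p ek (∅ : Finset ι) Φ c (univ : Finset I) (fun _ _ => v) 1) cube γ ∅) (lam12 W ρ) (lam12' adj W ρ) *
            Real.exp (-0 - ∑ X' : Finset I,
              (W6v blk Δ ℱ adj χ p ek (∅ : Finset ι) Φ c (univ : Finset I) (fun _ _ => v) cube (lam12' adj W ρ) (lam12 W ρ) L' nbar X' +
                (if X' = ∅ then pertP (fun t => Real.log (ztIn blk Δ ℱ χ p ek (∅ : Finset ι) Φ c (univ : Finset I) (fun _ _ => v) cube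
                  (lam12 W ρ) (lam12' adj W ρ) t)) nbar else 0)))) :=
  eq5145_zG_mod_W6v_of_ineq5144_loc blk Δ ℱ adj χ cube γ hR hD hnbr hθ0 hθ1 hβ0 hsmall (fun x y hxy _ => hΔ0 x y hxy) hΔ hχ hp
    (fun b hb => absurd hb (notMem_empty b)) one_pos (fun b hb => absurd hb (notMem_empty b)) (fun _ _ => measurable_const)
    (KY := fun _ => |v|) (fun _ _ _ => le_rfl) hek hek1 (fun b => absurd b.2 (notMem_empty _)) (fun _ _ _ _ => rfl) F hFloc hL W Bl 0 0
    (fun ρ X' => if X' = ∅ then pertP (fun t => Real.log (ztIn blk Δ ℱ χ p ek (∅ : Finset ι) Φ c (univ : Finset I) (fun _ _ => v) cube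
      (lam12 W ρ) (lam12' adj W ρ) t)) nbar else 0)
    (fun ρ _ X' _ t ht γ' =>
      ineq5144_locAct_witness blk ℱ adj χ p ek Φ c v hΔ0 hΔ hcube hθ0 hθ1 hβ1 hv0 hvθ (lam12' adj W ρ) X' ⟨ht.1.le, ht.2⟩ γ')
    (fun ρ _ => by simp)

/-- gen 5's numerical regime `16(D+1)²e²θ^{β′/2} ≤ 1` at `D = 0`, `β′ = 1`, `θ = e^{−12}`: `16e^{−4} ≤ 1` since `e ≥ 2`.
[cite: BalabanImbrieJaffe1988, p.310 (Sect. 5.14)] -/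
theorem toy_regime : 16 * (((0 : ℕ) : ℝ) + 1) ^ 2 * (Real.exp (-12) ^ ((1 : ℝ) / 2) * Real.exp 2) ≤ 1 := by
  rw [← Real.exp_mul, ← Real.exp_add, Nat.cast_zero, zero_add, one_pow, mul_one]
  norm_num
  have h2 : (2 : ℝ) ≤ Real.exp 1 := by linarith [Real.add_one_le_exp (1 : ℝ)]
  have h16 : (16 : ℝ) ≤ Real.exp 4 := by
    have : Real.exp 4 = Real.exp 1 ^ 4 := by rw [Real.exp_one_pow]; norm_num
    rw [this]; nlinarith [pow_le_pow_left₀ (by norm_num : (0 : ℝ) ≤ 2) h2 4]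
  rw [show (-4 : ℝ) = -(4 : ℝ) by norm_num, Real.exp_neg]
  exact (mul_inv_le_iff₀ (Real.exp_pos 4)).2 (by linarith)

omit [DecidableRel adj] in
/-- **THE LOCATED HEAD WITH EVERY NUMBER FIXED — ITS HYPOTHESIS FAMILY IS JOINTLY SATISFIABLE** (`adj = ⊥`, `D = 0`, `θ = v = e^{−12}`,
`β′ = 1`, `χ = gevreyCutoff`, `p = 1`, `e_k = e^{−2}`, `F ≡ 1`, `L′ = Unit`): only the model instance (`blk`, block-diagonal `Δ ≻ 0`, `ℱ`, the
cube map, `W`, `B_large`, `γ`) is displayed. [cite: BalabanImbrieJaffe1988, (5.14.5) p.312; (5.14.4) p.309] -/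
theorem eq5145_loc_instance_closed (hΔ0 : ∀ x y, blk x ≠ blk y → Δ x y = 0) (hΔ : Δ.PosDef) (hcube : ∀ Y, cube (Sum.inr Y) = Y.1)
    (W Bl : Finset I) {L : Type*} (γ : L → ↥(∅ : Finset ι) ⊕ ↥(univ : Finset I)) :
    Real.exp (-0) * expect blk Δ ℱ
        (fun i φ => fD (uD gevreyCutoff 1 (Real.exp (-2)) (∅ : Finset ι) Φ c (univ : Finset I) (fun _ _ => Real.exp (-12)) 1) cube γ ∅ i φ *
          (fun (_ : I) (_ : α → ℝ) => (1 : ℝ)) i φ) W (corner ℝ W) =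
      ∑ ρ ∈ (outer W Bl).filter (IsAdmissible fun _ _ : I => False),
        (∏ X ∈ ρ, g1 (fun _ _ : I => False) (zG blk Δ ℱ (fun i φ => fD (uD gevreyCutoff 1 (Real.exp (-2)) (∅ : Finset ι) Φ c
          (univ : Finset I) (fun _ _ => Real.exp (-12)) 1) cube γ ∅ i φ * (fun (_ : I) (_ : α → ℝ) => (1 : ℝ)) i φ)) X) *
          (zG blk Δ ℱ (fun i φ => fD (uD gevreyCutoff 1 (Real.exp (-2)) (∅ : Finset ι) Φ c (univ : Finset I) (fun _ _ => Real.exp (-12)) 1)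
                cube γ ∅ i φ * (fun (_ : I) (_ : α → ℝ) => (1 : ℝ)) i φ) (lam12 W ρ) (lam12' (fun _ _ : I => False) W ρ) /
              zG blk Δ ℱ (fD (uD gevreyCutoff 1 (Real.exp (-2)) (∅ : Finset ι) Φ c (univ : Finset I) (fun _ _ => Real.exp (-12)) 1) cube γ ∅)
                (lam12 W ρ) (lam12' (fun _ _ : I => False) W ρ) *
            Real.exp (-0 - ∑ X' : Finset I,
              (W6v blk Δ ℱ (fun _ _ : I => False) gevreyCutoff 1 (Real.exp (-2)) (∅ : Finset ι) Φ c (univ : Finset I)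
                  (fun _ _ => Real.exp (-12)) cube (lam12' (fun _ _ : I => False) W ρ) (lam12 W ρ) Unit 0 X' +
                (if X' = ∅ then pertP (fun t => Real.log (ztIn blk Δ ℱ gevreyCutoff 1 (Real.exp (-2)) (∅ : Finset ι) Φ c (univ : Finset I)
                  (fun _ _ => Real.exp (-12)) cube (lam12 W ρ) (lam12' (fun _ _ : I => False) W ρ) t)) 0 else 0)))) :=
  eq5145_loc_instance blk ℱ (fun _ _ : I => False) gevreyCutoff 1 (Real.exp (-2)) Φ c (Real.exp (-12)) hΔ0 hΔ hcube (nbr := fun _ => ∅)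
    (D := 0) (fun _ _ h => h.elim) (fun _ => by simp) (fun _ _ h => h.elim) (Real.exp_pos _) (Real.exp_le_one_iff.2 (by norm_num))
    zero_le_one le_rfl toy_regime chi1_nonneg (by norm_num) (Real.exp_pos _) (Real.exp_lt_exp.2 (by norm_num)) (Real.exp_pos _).le le_rfl
    (fun _ _ => (1 : ℝ)) (fun _ _ _ _ => rfl) (L' := Unit) (nbar := 0) (by simp) W Bl γ

/-- **… AND WITH THE MODEL INSTANCE FIXED TOO — A CLOSED THEOREM, NO HYPOTHESES**: one site, one cube (`α = I = Unit`, `blk = id`), `Δ = 1`,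
`ℱ = 0`, no χ-slot index (`ι = Unit`, `B = ∅`), the interaction slot of the cube, `W = univ`, `B_large = ∅`, one outer label.  The located head
theorem therefore has an instance: its hypothesis family is jointly satisfiable. [cite: BalabanImbrieJaffe1988, (5.14.5) p.312; (5.14.4) p.309] -/
theorem eq5145_loc_instance_unit :
    Real.exp (-0) * expect (id : Unit → Unit) (1 : Matrix Unit Unit ℝ) (0 : Unit → ℝ)
        (fun i φ => fD (uD gevreyCutoff 1 (Real.exp (-2)) (∅ : Finset Unit) (fun _ _ => (0 : ℝ)) (fun _ => (0 : ℝ)) (univ : Finset Unit)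
          (fun _ _ => Real.exp (-12)) 1) (fun _ => ()) (fun _ : Unit => Sum.inr ⟨(), mem_univ ()⟩) ∅ i φ *
          (fun (_ : Unit) (_ : Unit → ℝ) => (1 : ℝ)) i φ) univ (corner ℝ univ) =
      ∑ ρ ∈ (outer (univ : Finset Unit) ∅).filter (IsAdmissible fun _ _ : Unit => False),
        (∏ X ∈ ρ, g1 (fun _ _ : Unit => False) (zG (id : Unit → Unit) (1 : Matrix Unit Unit ℝ) (0 : Unit → ℝ)
          (fun i φ => fD (uD gevreyCutoff 1 (Real.exp (-2)) (∅ : Finset Unit) (fun _ _ => (0 : ℝ)) (fun _ => (0 : ℝ)) (univ : Finset Unit)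
            (fun _ _ => Real.exp (-12)) 1) (fun _ => ()) (fun _ : Unit => Sum.inr ⟨(), mem_univ ()⟩) ∅ i φ *
            (fun (_ : Unit) (_ : Unit → ℝ) => (1 : ℝ)) i φ)) X) *
          (zG (id : Unit → Unit) (1 : Matrix Unit Unit ℝ) (0 : Unit → ℝ)
              (fun i φ => fD (uD gevreyCutoff 1 (Real.exp (-2)) (∅ : Finset Unit) (fun _ _ => (0 : ℝ)) (fun _ => (0 : ℝ))
                (univ : Finset Unit) (fun _ _ => Real.exp (-12)) 1) (fun _ => ()) (fun _ : Unit => Sum.inr ⟨(), mem_univ ()⟩) ∅ i φ *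
                (fun (_ : Unit) (_ : Unit → ℝ) => (1 : ℝ)) i φ) (lam12 univ ρ) (lam12' (fun _ _ : Unit => False) univ ρ) /
              zG (id : Unit → Unit) (1 : Matrix Unit Unit ℝ) (0 : Unit → ℝ)
                (fD (uD gevreyCutoff 1 (Real.exp (-2)) (∅ : Finset Unit) (fun _ _ => (0 : ℝ)) (fun _ => (0 : ℝ)) (univ : Finset Unit)
                  (fun _ _ => Real.exp (-12)) 1) (fun _ => ()) (fun _ : Unit => Sum.inr ⟨(), mem_univ ()⟩) ∅)
                (lam12 univ ρ) (lam12' (fun _ _ : Unit => False) univ ρ) *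
            Real.exp (-0 - ∑ X' : Finset Unit,
              (W6v (id : Unit → Unit) (1 : Matrix Unit Unit ℝ) (0 : Unit → ℝ) (fun _ _ : Unit => False) gevreyCutoff 1 (Real.exp (-2))
                  (∅ : Finset Unit) (fun _ _ => (0 : ℝ)) (fun _ => (0 : ℝ)) (univ : Finset Unit) (fun _ _ => Real.exp (-12)) (fun _ => ())
                  (lam12' (fun _ _ : Unit => False) univ ρ) (lam12 univ ρ) Unit 0 X' +
                (if X' = ∅ then pertP (fun t => Real.log (ztIn (id : Unit → Unit) (1 : Matrix Unit Unit ℝ) (0 : Unit → ℝ) gevreyCutoff 1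
                  (Real.exp (-2)) (∅ : Finset Unit) (fun _ _ => (0 : ℝ)) (fun _ => (0 : ℝ)) (univ : Finset Unit) (fun _ _ => Real.exp (-12))
                  (fun _ => ()) (lam12 univ ρ) (lam12' (fun _ _ : Unit => False) univ ρ) t)) 0 else 0)))) :=
  eq5145_loc_instance_closed (id : Unit → Unit) (Δ := 1) (0 : Unit → ℝ) (fun _ _ => (0 : ℝ)) (fun _ => (0 : ℝ)) (cube := fun _ => ())
    (fun _ _ h => absurd (Subsingleton.elim _ _) h) Matrix.PosDef.one (fun _ => rfl) univ ∅ (fun _ : Unit => Sum.inr ⟨(), mem_univ ()⟩)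

end Literature.MathematicalPhysics.QuantumFieldTheory.BalabanImbrieJaffe1984to88.BIJ88Eq5145LocatedInstance

end
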